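import Mathlib
import HarnessLib
import Summits.HubbardSuperconductivity.HubbardSuperconductivity.Theorems.KLProgrammePerturbedFermiCurveHigherDerivsBand

/-!
# Route `KLProgramme` — the STRUCTURED chain rule to order four for `θ ↦ F(γ(θ))` (`F` a `C⁴` scalar field on a normed space, `γ` a `C⁴`
# curve), with the Stirling/Bell bound `|∂ʲ(F∘γ)| ≤ (Σ_k S(j,k)·M_k)·Dʲ`, `j ≤ 4`

Cell `gate-hubbard-kl`, seat hubbard-kl-k3c3-p3 (g3; row «implicit-function / monotonicity route»).  Frame-side input of the ENGINE child's
two-leg stubs (stmt-HubbardSuperconductivity-19855; clause (E3g) `TwoLegAngularG`, `ν_n(K) = evalM (D_n(K)) ∘ (toLp ∘ k_F^K)`).  The reduction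
in the tree (`abs_iteratedDeriv_klLocalPart_le` via Mathlib's `norm_iteratedFDeriv_comp_le`) is SINGLE-constant in the outer function
(`‖DⁱF‖ ≤ C ∀ i ≤ 4 ⇒ |∂ʲ(F∘γ)| ≤ j!·C·Dʲ`); the scale-`n` two-leg data are GRADED (BGM (2.36): orders `≤ 2` are `O(U²)`, order 3 `O(U²4ⁿ)`,
order 4 `O(U²4^{2n})`), and with `C` the order-4 size the order-ONE fit against `angBar … 1 ∝ |U|·4^{N+1}` fails at depth.  Cure = the structured
bound, in which the order-`k` size of `F` meets curve factors of total order `j` only: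
* §1 the `HasDerivAt` chain of orders 1–4 for `F ∘ γ₀` along a derivative tower `γ₁ … γ₄` (nested `fderiv`s, `HasDerivAt.clm_apply`; the
  level-set versions are p476128's `level_chain_*`); §2 `iteratedDeriv j (F ∘ γ)` = the order-`j` expression for a `C⁴` curve;
* §3 with `‖DᵏF(γ θ)‖ ≤ M_k`, `‖γ^{(i)}(θ)‖ ≤ Dⁱ`: `|∂¹| ≤ M₁D`, `|∂²| ≤ (M₂+M₁)D²`, `|∂³| ≤ (M₃+3M₂+M₁)D³`, `|∂⁴| ≤ (M₄+6M₃+7M₂+M₁)D⁴`;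
  §4 packaged form and the uniform envelope `|∂ʲ| ≤ 7·(Σ_{k=1}^{j} M_k)·Dʲ` (`1 ≤ j ≤ 4`).
Everything is PROVED; no definitions; carrier-free; nothing about the Hubbard model.  References: Faà di Bruno's formula [folklore];
BGM 2006 §2.4 (2.36)/(2.40) [cite: BenfattoGiulianiMastropietro2006] for the graded sizes it serves.
-/

noncomputable section

namespace Summit.HubbardSuperconductivity.HubbardSuperconductivity.Theorems.PerturbedFermiCurve

set_option linter.dupNamespace false -- summit = problem name (single-conjunct summit), D-0017
set_option maxSynthPendingDepth 3 -- nested operator-norm instances `V →L V →L V →L ℝ` (third/fourth Fréchet derivatives)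

open Real Set Finset

/-! ## §1 The chain: `HasDerivAt` identities of orders one to four for `F ∘ γ₀` -/

section Chain

variable {V : Type*} [NormedAddCommGroup V] [NormedSpace ℝ V] {F : V → ℝ} {γ₀ γ₁ γ₂ γ₃ γ₄ : ℝ → V}

/-- **Order 1**: `(F∘γ₀)′(θ) = DF(γ₀ θ)[γ₁ θ]`. [folklore] -/
theorem comp_chain_one (hF : ContDiff ℝ 1 F) (hγ₀ : ∀ ϑ, HasDerivAt γ₀ (γ₁ ϑ) ϑ) (θ : ℝ) :
    HasDerivAt (F ∘ γ₀) (fderiv ℝ F (γ₀ θ) (γ₁ θ)) θ := by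
  have hD : HasFDerivAt F (fderiv ℝ F (γ₀ θ)) (γ₀ θ) := ((hF.differentiable one_ne_zero) _).hasFDerivAt
  exact hD.comp_hasDerivAt θ (hγ₀ θ)

/-- **Order 2**: `(DF(γ₀)[γ₁])′(θ) = D²F(γ₀ θ)[γ₁ θ, γ₁ θ] + DF(γ₀ θ)[γ₂ θ]`. [folklore] -/
theorem comp_chain_two (hF : ContDiff ℝ 2 F) (hγ₀ : ∀ ϑ, HasDerivAt γ₀ (γ₁ ϑ) ϑ) (hγ₁ : ∀ ϑ, HasDerivAt γ₁ (γ₂ ϑ) ϑ) (θ : ℝ) :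
    HasDerivAt (fun ϑ => fderiv ℝ F (γ₀ ϑ) (γ₁ ϑ))
      (fderiv ℝ (fderiv ℝ F) (γ₀ θ) (γ₁ θ) (γ₁ θ) + fderiv ℝ F (γ₀ θ) (γ₂ θ)) θ := by
  have hF1 : ContDiff ℝ 1 (fderiv ℝ F) := hF.fderiv_right (by norm_num)
  have hD1 : HasFDerivAt (fderiv ℝ F) (fderiv ℝ (fderiv ℝ F) (γ₀ θ)) (γ₀ θ) :=
    ((hF1.differentiable one_ne_zero) _).hasFDerivAt
  have hc : HasDerivAt (fun ϑ => fderiv ℝ F (γ₀ ϑ)) (fderiv ℝ (fderiv ℝ F) (γ₀ θ) (γ₁ θ)) θ := hD1.comp_hasDerivAt θ (hγ₀ θ)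
  exact hc.clm_apply (hγ₁ θ)

/-- **Order 3**: the derivative of the order-2 expression is the five-term order-3 expression
`D³F[γ₁,γ₁,γ₁] + D²F[γ₂,γ₁] + D²F[γ₁,γ₂] + (D²F[γ₁,γ₂] + DF[γ₃])` (terms in product-rule order). [folklore] -/
theorem comp_chain_three (hF : ContDiff ℝ 3 F) (hγ₀ : ∀ ϑ, HasDerivAt γ₀ (γ₁ ϑ) ϑ) (hγ₁ : ∀ ϑ, HasDerivAt γ₁ (γ₂ ϑ) ϑ)
    (hγ₂ : ∀ ϑ, HasDerivAt γ₂ (γ₃ ϑ) ϑ) (θ : ℝ) :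
    HasDerivAt (fun ϑ => fderiv ℝ (fderiv ℝ F) (γ₀ ϑ) (γ₁ ϑ) (γ₁ ϑ) + fderiv ℝ F (γ₀ ϑ) (γ₂ ϑ))
      (fderiv ℝ (fderiv ℝ (fderiv ℝ F)) (γ₀ θ) (γ₁ θ) (γ₁ θ) (γ₁ θ) + fderiv ℝ (fderiv ℝ F) (γ₀ θ) (γ₂ θ) (γ₁ θ) +
          fderiv ℝ (fderiv ℝ F) (γ₀ θ) (γ₁ θ) (γ₂ θ) +
        (fderiv ℝ (fderiv ℝ F) (γ₀ θ) (γ₁ θ) (γ₂ θ) + fderiv ℝ F (γ₀ θ) (γ₃ θ))) θ := by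
  have hF1 : ContDiff ℝ 2 (fderiv ℝ F) := hF.fderiv_right (by norm_num)
  have hF2 : ContDiff ℝ 1 (fderiv ℝ (fderiv ℝ F)) := hF1.fderiv_right (by norm_num)
  have hD1 : HasFDerivAt (fderiv ℝ F) (fderiv ℝ (fderiv ℝ F) (γ₀ θ)) (γ₀ θ) :=
    ((hF1.differentiable (by norm_num)) _).hasFDerivAt
  have hD2 : HasFDerivAt (fderiv ℝ (fderiv ℝ F)) (fderiv ℝ (fderiv ℝ (fderiv ℝ F)) (γ₀ θ)) (γ₀ θ) :=
    ((hF2.differentiable one_ne_zero) _).hasFDerivAt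
  have hc1 : HasDerivAt (fun ϑ => fderiv ℝ F (γ₀ ϑ)) (fderiv ℝ (fderiv ℝ F) (γ₀ θ) (γ₁ θ)) θ :=
    hD1.comp_hasDerivAt θ (hγ₀ θ)
  have hc2 : HasDerivAt (fun ϑ => fderiv ℝ (fderiv ℝ F) (γ₀ ϑ)) (fderiv ℝ (fderiv ℝ (fderiv ℝ F)) (γ₀ θ) (γ₁ θ)) θ :=
    hD2.comp_hasDerivAt θ (hγ₀ θ)
  have hA := (hc2.clm_apply (hγ₁ θ)).clm_apply (hγ₁ θ)
  have hB := hc1.clm_apply (hγ₂ θ)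
  have hT := hA.add hB
  simp only [add_apply] at hT
  exact hT

/-- **Order 4**: the derivative of the order-3 expression is the fifteen-term order-4 expression (one `D⁴F[γ₁⁴]`, six `D³F[γ₂,γ₁,γ₁]`-type,
three `D²F[γ₂,γ₂]`, four `D²F[γ₃,γ₁]`-type, one `DF[γ₄]`: the partition count `1 + 6 + 3 + 4 + 1 = 15 = B₄`). [folklore] -/
theorem comp_chain_four (hF : ContDiff ℝ 4 F) (hγ₀ : ∀ ϑ, HasDerivAt γ₀ (γ₁ ϑ) ϑ) (hγ₁ : ∀ ϑ, HasDerivAt γ₁ (γ₂ ϑ) ϑ)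
    (hγ₂ : ∀ ϑ, HasDerivAt γ₂ (γ₃ ϑ) ϑ) (hγ₃ : ∀ ϑ, HasDerivAt γ₃ (γ₄ ϑ) ϑ) (θ : ℝ) :
    HasDerivAt (fun ϑ => fderiv ℝ (fderiv ℝ (fderiv ℝ F)) (γ₀ ϑ) (γ₁ ϑ) (γ₁ ϑ) (γ₁ ϑ) +
        fderiv ℝ (fderiv ℝ F) (γ₀ ϑ) (γ₂ ϑ) (γ₁ ϑ) + fderiv ℝ (fderiv ℝ F) (γ₀ ϑ) (γ₁ ϑ) (γ₂ ϑ) +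
        (fderiv ℝ (fderiv ℝ F) (γ₀ ϑ) (γ₁ ϑ) (γ₂ ϑ) + fderiv ℝ F (γ₀ ϑ) (γ₃ ϑ)))
      (fderiv ℝ (fderiv ℝ (fderiv ℝ (fderiv ℝ F))) (γ₀ θ) (γ₁ θ) (γ₁ θ) (γ₁ θ) (γ₁ θ) +
          fderiv ℝ (fderiv ℝ (fderiv ℝ F)) (γ₀ θ) (γ₂ θ) (γ₁ θ) (γ₁ θ) +
          fderiv ℝ (fderiv ℝ (fderiv ℝ F)) (γ₀ θ) (γ₁ θ) (γ₂ θ) (γ₁ θ) +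
          fderiv ℝ (fderiv ℝ (fderiv ℝ F)) (γ₀ θ) (γ₁ θ) (γ₁ θ) (γ₂ θ) +
        (fderiv ℝ (fderiv ℝ (fderiv ℝ F)) (γ₀ θ) (γ₁ θ) (γ₂ θ) (γ₁ θ) + fderiv ℝ (fderiv ℝ F) (γ₀ θ) (γ₃ θ) (γ₁ θ) +
          fderiv ℝ (fderiv ℝ F) (γ₀ θ) (γ₂ θ) (γ₂ θ)) +
        (fderiv ℝ (fderiv ℝ (fderiv ℝ F)) (γ₀ θ) (γ₁ θ) (γ₁ θ) (γ₂ θ) + fderiv ℝ (fderiv ℝ F) (γ₀ θ) (γ₂ θ) (γ₂ θ) +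
          fderiv ℝ (fderiv ℝ F) (γ₀ θ) (γ₁ θ) (γ₃ θ)) +
        (fderiv ℝ (fderiv ℝ (fderiv ℝ F)) (γ₀ θ) (γ₁ θ) (γ₁ θ) (γ₂ θ) + fderiv ℝ (fderiv ℝ F) (γ₀ θ) (γ₂ θ) (γ₂ θ) +
          fderiv ℝ (fderiv ℝ F) (γ₀ θ) (γ₁ θ) (γ₃ θ)) +
        (fderiv ℝ (fderiv ℝ F) (γ₀ θ) (γ₁ θ) (γ₃ θ) + fderiv ℝ F (γ₀ θ) (γ₄ θ))) θ := by
  have hF1 : ContDiff ℝ 3 (fderiv ℝ F) := hF.fderiv_right (by norm_num)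
  have hF2 : ContDiff ℝ 2 (fderiv ℝ (fderiv ℝ F)) := hF1.fderiv_right (by norm_num)
  have hF3 : ContDiff ℝ 1 (fderiv ℝ (fderiv ℝ (fderiv ℝ F))) := hF2.fderiv_right (by norm_num)
  have hD1 : HasFDerivAt (fderiv ℝ F) (fderiv ℝ (fderiv ℝ F) (γ₀ θ)) (γ₀ θ) :=
    ((hF1.differentiable (by norm_num)) _).hasFDerivAt
  have hD2 : HasFDerivAt (fderiv ℝ (fderiv ℝ F)) (fderiv ℝ (fderiv ℝ (fderiv ℝ F)) (γ₀ θ)) (γ₀ θ) :=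
    ((hF2.differentiable (by norm_num)) _).hasFDerivAt
  have hD3 : HasFDerivAt (fderiv ℝ (fderiv ℝ (fderiv ℝ F))) (fderiv ℝ (fderiv ℝ (fderiv ℝ (fderiv ℝ F))) (γ₀ θ)) (γ₀ θ) :=
    ((hF3.differentiable one_ne_zero) _).hasFDerivAt
  have hc1 : HasDerivAt (fun ϑ => fderiv ℝ F (γ₀ ϑ)) (fderiv ℝ (fderiv ℝ F) (γ₀ θ) (γ₁ θ)) θ :=
    hD1.comp_hasDerivAt θ (hγ₀ θ)
  have hc2 : HasDerivAt (fun ϑ => fderiv ℝ (fderiv ℝ F) (γ₀ ϑ)) (fderiv ℝ (fderiv ℝ (fderiv ℝ F)) (γ₀ θ) (γ₁ θ)) θ :=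
    hD2.comp_hasDerivAt θ (hγ₀ θ)
  have hc3 : HasDerivAt (fun ϑ => fderiv ℝ (fderiv ℝ (fderiv ℝ F)) (γ₀ ϑ))
      (fderiv ℝ (fderiv ℝ (fderiv ℝ (fderiv ℝ F))) (γ₀ θ) (γ₁ θ)) θ := hD3.comp_hasDerivAt θ (hγ₀ θ)
  -- the five terms of the order-3 expression, differentiated
  have h1 := ((hc3.clm_apply (hγ₁ θ)).clm_apply (hγ₁ θ)).clm_apply (hγ₁ θ)
  have h2 := (hc2.clm_apply (hγ₂ θ)).clm_apply (hγ₁ θ)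
  have h3 := (hc2.clm_apply (hγ₁ θ)).clm_apply (hγ₂ θ)
  have h5 := hc1.clm_apply (hγ₃ θ)
  have hT := ((h1.add h2).add h3).add (h3.add h5)
  simp only [add_apply] at hT
  refine hT.congr_deriv ?_
  ring

end Chain

/-! ## §2 The iterated derivatives of `F ∘ γ` for a `C⁴` curve `γ` -/

section Iterated

variable {V : Type*} [NormedAddCommGroup V] [NormedSpace ℝ V] {F : V → ℝ} {γ : ℝ → V}

/-- The derivative tower of a `C⁴` curve: `iteratedDeriv i γ` has derivative `iteratedDeriv (i+1) γ` for `i < 4`. [folklore] -/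
theorem hasDerivAt_iteratedDeriv_of_contDiff_four (hγ : ContDiff ℝ 4 γ) {i : ℕ} (hi : i < 4) (ϑ : ℝ) :
    HasDerivAt (iteratedDeriv i γ) (iteratedDeriv (i + 1) γ ϑ) ϑ := by
  have hd : Differentiable ℝ (iteratedDeriv i γ) := hγ.differentiable_iteratedDeriv i (by exact_mod_cast hi)
  rw [iteratedDeriv_succ]
  exact (hd ϑ).hasDerivAt

/-- **`∂¹(F∘γ) = DF(γ)[γ′]`**. [folklore] -/
theorem iteratedDeriv_one_comp_eq (hF : ContDiff ℝ 4 F) (hγ : ContDiff ℝ 4 γ) (θ : ℝ) :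
    iteratedDeriv 1 (F ∘ γ) θ = fderiv ℝ F (γ θ) (iteratedDeriv 1 γ θ) := by
  have h0 := fun ϑ => hasDerivAt_iteratedDeriv_of_contDiff_four hγ (show 0 < 4 by norm_num) ϑ
  simp only [iteratedDeriv_zero] at h0
  rw [iteratedDeriv_one]
  exact (comp_chain_one (hF.of_le (by norm_num)) h0 θ).deriv

/-- **`∂²(F∘γ) = D²F(γ)[γ′,γ′] + DF(γ)[γ″]`**. [folklore] -/
theorem iteratedDeriv_two_comp_eq (hF : ContDiff ℝ 4 F) (hγ : ContDiff ℝ 4 γ) (θ : ℝ) :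
    iteratedDeriv 2 (F ∘ γ) θ =
      fderiv ℝ (fderiv ℝ F) (γ θ) (iteratedDeriv 1 γ θ) (iteratedDeriv 1 γ θ) + fderiv ℝ F (γ θ) (iteratedDeriv 2 γ θ) := by
  have h0 := fun ϑ => hasDerivAt_iteratedDeriv_of_contDiff_four hγ (show 0 < 4 by norm_num) ϑ
  simp only [iteratedDeriv_zero] at h0
  have h1 := fun ϑ => hasDerivAt_iteratedDeriv_of_contDiff_four hγ (show 1 < 4 by norm_num) ϑ
  have hE1 : iteratedDeriv 1 (F ∘ γ) = fun ϑ => fderiv ℝ F (γ ϑ) (iteratedDeriv 1 γ ϑ) :=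
    funext fun ϑ => iteratedDeriv_one_comp_eq hF hγ ϑ
  rw [show (2 : ℕ) = 1 + 1 from rfl, iteratedDeriv_succ, hE1]
  exact (comp_chain_two (hF.of_le (by norm_num)) h0 h1 θ).deriv

/-- **`∂³(F∘γ)`** = the five-term order-3 chain expression at `γ_i = iteratedDeriv i γ`. [folklore] -/
theorem iteratedDeriv_three_comp_eq (hF : ContDiff ℝ 4 F) (hγ : ContDiff ℝ 4 γ) (θ : ℝ) :
    iteratedDeriv 3 (F ∘ γ) θ =
      fderiv ℝ (fderiv ℝ (fderiv ℝ F)) (γ θ) (iteratedDeriv 1 γ θ) (iteratedDeriv 1 γ θ) (iteratedDeriv 1 γ θ) +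
            fderiv ℝ (fderiv ℝ F) (γ θ) (iteratedDeriv 2 γ θ) (iteratedDeriv 1 γ θ) +
          fderiv ℝ (fderiv ℝ F) (γ θ) (iteratedDeriv 1 γ θ) (iteratedDeriv 2 γ θ) +
        (fderiv ℝ (fderiv ℝ F) (γ θ) (iteratedDeriv 1 γ θ) (iteratedDeriv 2 γ θ) + fderiv ℝ F (γ θ) (iteratedDeriv 3 γ θ)) := by
  have h0 := fun ϑ => hasDerivAt_iteratedDeriv_of_contDiff_four hγ (show 0 < 4 by norm_num) ϑ
  simp only [iteratedDeriv_zero] at h0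
  have h1 := fun ϑ => hasDerivAt_iteratedDeriv_of_contDiff_four hγ (show 1 < 4 by norm_num) ϑ
  have h2 := fun ϑ => hasDerivAt_iteratedDeriv_of_contDiff_four hγ (show 2 < 4 by norm_num) ϑ
  have hE2 : iteratedDeriv 2 (F ∘ γ) = fun ϑ =>
      fderiv ℝ (fderiv ℝ F) (γ ϑ) (iteratedDeriv 1 γ ϑ) (iteratedDeriv 1 γ ϑ) + fderiv ℝ F (γ ϑ) (iteratedDeriv 2 γ ϑ) :=
    funext fun ϑ => iteratedDeriv_two_comp_eq hF hγ ϑ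
  rw [show (3 : ℕ) = 2 + 1 from rfl, iteratedDeriv_succ, hE2]
  exact (comp_chain_three (hF.of_le (by norm_num)) h0 h1 h2 θ).deriv

/-- **`∂⁴(F∘γ)`** = the fifteen-term order-4 chain expression at `γ_i = iteratedDeriv i γ`. [folklore] -/
theorem iteratedDeriv_four_comp_eq (hF : ContDiff ℝ 4 F) (hγ : ContDiff ℝ 4 γ) (θ : ℝ) :
    iteratedDeriv 4 (F ∘ γ) θ =
      fderiv ℝ (fderiv ℝ (fderiv ℝ (fderiv ℝ F))) (γ θ) (iteratedDeriv 1 γ θ) (iteratedDeriv 1 γ θ) (iteratedDeriv 1 γ θ)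
              (iteratedDeriv 1 γ θ) +
            fderiv ℝ (fderiv ℝ (fderiv ℝ F)) (γ θ) (iteratedDeriv 2 γ θ) (iteratedDeriv 1 γ θ) (iteratedDeriv 1 γ θ) +
            fderiv ℝ (fderiv ℝ (fderiv ℝ F)) (γ θ) (iteratedDeriv 1 γ θ) (iteratedDeriv 2 γ θ) (iteratedDeriv 1 γ θ) +
            fderiv ℝ (fderiv ℝ (fderiv ℝ F)) (γ θ) (iteratedDeriv 1 γ θ) (iteratedDeriv 1 γ θ) (iteratedDeriv 2 γ θ) +
          (fderiv ℝ (fderiv ℝ (fderiv ℝ F)) (γ θ) (iteratedDeriv 1 γ θ) (iteratedDeriv 2 γ θ) (iteratedDeriv 1 γ θ) +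
              fderiv ℝ (fderiv ℝ F) (γ θ) (iteratedDeriv 3 γ θ) (iteratedDeriv 1 γ θ) +
            fderiv ℝ (fderiv ℝ F) (γ θ) (iteratedDeriv 2 γ θ) (iteratedDeriv 2 γ θ)) +
          (fderiv ℝ (fderiv ℝ (fderiv ℝ F)) (γ θ) (iteratedDeriv 1 γ θ) (iteratedDeriv 1 γ θ) (iteratedDeriv 2 γ θ) +
              fderiv ℝ (fderiv ℝ F) (γ θ) (iteratedDeriv 2 γ θ) (iteratedDeriv 2 γ θ) +
            fderiv ℝ (fderiv ℝ F) (γ θ) (iteratedDeriv 1 γ θ) (iteratedDeriv 3 γ θ)) +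
          (fderiv ℝ (fderiv ℝ (fderiv ℝ F)) (γ θ) (iteratedDeriv 1 γ θ) (iteratedDeriv 1 γ θ) (iteratedDeriv 2 γ θ) +
              fderiv ℝ (fderiv ℝ F) (γ θ) (iteratedDeriv 2 γ θ) (iteratedDeriv 2 γ θ) +
            fderiv ℝ (fderiv ℝ F) (γ θ) (iteratedDeriv 1 γ θ) (iteratedDeriv 3 γ θ)) +
        (fderiv ℝ (fderiv ℝ F) (γ θ) (iteratedDeriv 1 γ θ) (iteratedDeriv 3 γ θ) + fderiv ℝ F (γ θ) (iteratedDeriv 4 γ θ)) := by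
  have h0 := fun ϑ => hasDerivAt_iteratedDeriv_of_contDiff_four hγ (show 0 < 4 by norm_num) ϑ
  simp only [iteratedDeriv_zero] at h0
  have h1 := fun ϑ => hasDerivAt_iteratedDeriv_of_contDiff_four hγ (show 1 < 4 by norm_num) ϑ
  have h2 := fun ϑ => hasDerivAt_iteratedDeriv_of_contDiff_four hγ (show 2 < 4 by norm_num) ϑ
  have h3 := fun ϑ => hasDerivAt_iteratedDeriv_of_contDiff_four hγ (show 3 < 4 by norm_num) ϑ
  have hE3 := funext fun ϑ => iteratedDeriv_three_comp_eq hF hγ ϑ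
  rw [show (4 : ℕ) = 3 + 1 from rfl, iteratedDeriv_succ, hE3]
  exact (comp_chain_four hF h0 h1 h2 h3 θ).deriv

end Iterated

/-! ## §3 The structured bounds: Stirling coefficients `1 | 1,1 | 1,3,1 | 1,6,7,1` -/

section Bounds

variable {V : Type*} [NormedAddCommGroup V] [NormedSpace ℝ V] {F : V → ℝ} {γ : ℝ → V}
  (hF : ContDiff ℝ 4 F) (hγ : ContDiff ℝ 4 γ) {θ M₁ M₂ M₃ M₄ D : ℝ}
  (hM₁ : ‖iteratedFDeriv ℝ 1 F (γ θ)‖ ≤ M₁) (hM₂ : ‖iteratedFDeriv ℝ 2 F (γ θ)‖ ≤ M₂)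
  (hM₃ : ‖iteratedFDeriv ℝ 3 F (γ θ)‖ ≤ M₃) (hM₄ : ‖iteratedFDeriv ℝ 4 F (γ θ)‖ ≤ M₄)
  (hD₁ : ‖iteratedDeriv 1 γ θ‖ ≤ D) (hD₂ : ‖iteratedDeriv 2 γ θ‖ ≤ D ^ 2) (hD₃ : ‖iteratedDeriv 3 γ θ‖ ≤ D ^ 3)
  (hD₄ : ‖iteratedDeriv 4 γ θ‖ ≤ D ^ 4)
include hF hγ

section One
include hM₁ hD₁

/-- **Order 1**: `|∂(F∘γ)(θ)| ≤ M₁·D`. [folklore] -/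
theorem abs_iteratedDeriv_one_comp_le : |iteratedDeriv 1 (F ∘ γ) θ| ≤ M₁ * D := by
  rw [iteratedDeriv_one_comp_eq hF hγ θ]
  have hE₁ : ‖fderiv ℝ F (γ θ)‖ ≤ M₁ := by rw [norm_fderiv_eq_norm_iteratedFDeriv_one]; exact hM₁
  have hM0 : 0 ≤ M₁ := (norm_nonneg _).trans hE₁
  calc |fderiv ℝ F (γ θ) (iteratedDeriv 1 γ θ)| ≤ M₁ * ‖iteratedDeriv 1 γ θ‖ := abs_apply_le_of_opNorm_le _ hE₁ _
    _ ≤ M₁ * D := by gcongr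

end One

section Two
include hM₁ hM₂ hD₁ hD₂

/-- **Order 2**: `|∂²(F∘γ)(θ)| ≤ (M₂ + M₁)·D²`. [folklore] -/
theorem abs_iteratedDeriv_two_comp_le : |iteratedDeriv 2 (F ∘ γ) θ| ≤ (M₂ + M₁) * D ^ 2 := by
  rw [iteratedDeriv_two_comp_eq hF hγ θ]
  have hE₁ : ‖fderiv ℝ F (γ θ)‖ ≤ M₁ := by rw [norm_fderiv_eq_norm_iteratedFDeriv_one]; exact hM₁
  have hE₂ : ‖fderiv ℝ (fderiv ℝ F) (γ θ)‖ ≤ M₂ := by rw [norm_fderiv_two_eq_norm_iteratedFDeriv]; exact hM₂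
  have hM10 : 0 ≤ M₁ := (norm_nonneg _).trans hE₁; have hM20 : 0 ≤ M₂ := (norm_nonneg _).trans hE₂
  have hD0 : 0 ≤ D := (norm_nonneg _).trans hD₁
  set v₁ := iteratedDeriv 1 γ θ; set v₂ := iteratedDeriv 2 γ θ
  have h2 : |fderiv ℝ (fderiv ℝ F) (γ θ) v₁ v₁| ≤ M₂ * D ^ 2 := by
    calc _ ≤ M₂ * ‖v₁‖ * ‖v₁‖ := abs_apply₂_le_of_opNorm_le _ hE₂ _ _
      _ ≤ M₂ * D * D := by gcongr
      _ = M₂ * D ^ 2 := by ring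
  have h1 : |fderiv ℝ F (γ θ) v₂| ≤ M₁ * D ^ 2 := (abs_apply_le_of_opNorm_le _ hE₁ _).trans (by gcongr)
  calc _ ≤ M₂ * D ^ 2 + M₁ * D ^ 2 := abs_add_le_add h2 h1
    _ = (M₂ + M₁) * D ^ 2 := by ring

end Two

section Three
include hM₁ hM₂ hM₃ hD₁ hD₂ hD₃

/-- **Order 3**: `|∂³(F∘γ)(θ)| ≤ (M₃ + 3M₂ + M₁)·D³`. [folklore] -/
theorem abs_iteratedDeriv_three_comp_le : |iteratedDeriv 3 (F ∘ γ) θ| ≤ (M₃ + 3 * M₂ + M₁) * D ^ 3 := by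
  rw [iteratedDeriv_three_comp_eq hF hγ θ]
  have hE₁ : ‖fderiv ℝ F (γ θ)‖ ≤ M₁ := by rw [norm_fderiv_eq_norm_iteratedFDeriv_one]; exact hM₁
  have hE₂ : ‖fderiv ℝ (fderiv ℝ F) (γ θ)‖ ≤ M₂ := by rw [norm_fderiv_two_eq_norm_iteratedFDeriv]; exact hM₂
  have hE₃ : ‖fderiv ℝ (fderiv ℝ (fderiv ℝ F)) (γ θ)‖ ≤ M₃ := by rw [norm_fderiv_three_eq_norm_iteratedFDeriv]; exact hM₃
  have hM10 : 0 ≤ M₁ := (norm_nonneg _).trans hE₁; have hM20 : 0 ≤ M₂ := (norm_nonneg _).trans hE₂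
  have hM30 : 0 ≤ M₃ := (norm_nonneg _).trans hE₃; have hD0 : 0 ≤ D := (norm_nonneg _).trans hD₁
  set v₁ := iteratedDeriv 1 γ θ; set v₂ := iteratedDeriv 2 γ θ; set v₃ := iteratedDeriv 3 γ θ
  have h3 : |fderiv ℝ (fderiv ℝ (fderiv ℝ F)) (γ θ) v₁ v₁ v₁| ≤ M₃ * D ^ 3 := by
    calc _ ≤ M₃ * ‖v₁‖ * ‖v₁‖ * ‖v₁‖ := abs_apply₃_le_of_opNorm_le _ hE₃ _ _ _
      _ ≤ M₃ * D * D * D := by gcongr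
      _ = M₃ * D ^ 3 := by ring
  have h21 : |fderiv ℝ (fderiv ℝ F) (γ θ) v₂ v₁| ≤ M₂ * D ^ 3 := by
    calc _ ≤ M₂ * ‖v₂‖ * ‖v₁‖ := abs_apply₂_le_of_opNorm_le _ hE₂ _ _
      _ ≤ M₂ * D ^ 2 * D := by gcongr
      _ = M₂ * D ^ 3 := by ring
  have h12 : |fderiv ℝ (fderiv ℝ F) (γ θ) v₁ v₂| ≤ M₂ * D ^ 3 := by
    calc _ ≤ M₂ * ‖v₁‖ * ‖v₂‖ := abs_apply₂_le_of_opNorm_le _ hE₂ _ _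
      _ ≤ M₂ * D * D ^ 2 := by gcongr
      _ = M₂ * D ^ 3 := by ring
  have h1 : |fderiv ℝ F (γ θ) v₃| ≤ M₁ * D ^ 3 := (abs_apply_le_of_opNorm_le _ hE₁ _).trans (by gcongr)
  calc _ ≤ M₃ * D ^ 3 + M₂ * D ^ 3 + M₂ * D ^ 3 + (M₂ * D ^ 3 + M₁ * D ^ 3) :=
        abs_add_le_add (abs_add_le_add (abs_add_le_add h3 h21) h12) (abs_add_le_add h12 h1)
    _ = (M₃ + 3 * M₂ + M₁) * D ^ 3 := by ring

end Three

section Four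
include hM₁ hM₂ hM₃ hM₄ hD₁ hD₂ hD₃ hD₄

/-- **Order 4**: `|∂⁴(F∘γ)(θ)| ≤ (M₄ + 6M₃ + 7M₂ + M₁)·D⁴`. [folklore] -/
theorem abs_iteratedDeriv_four_comp_le : |iteratedDeriv 4 (F ∘ γ) θ| ≤ (M₄ + 6 * M₃ + 7 * M₂ + M₁) * D ^ 4 := by
  rw [iteratedDeriv_four_comp_eq hF hγ θ]
  have hE₁ : ‖fderiv ℝ F (γ θ)‖ ≤ M₁ := by rw [norm_fderiv_eq_norm_iteratedFDeriv_one]; exact hM₁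
  have hE₂ : ‖fderiv ℝ (fderiv ℝ F) (γ θ)‖ ≤ M₂ := by rw [norm_fderiv_two_eq_norm_iteratedFDeriv]; exact hM₂
  have hE₃ : ‖fderiv ℝ (fderiv ℝ (fderiv ℝ F)) (γ θ)‖ ≤ M₃ := by rw [norm_fderiv_three_eq_norm_iteratedFDeriv]; exact hM₃
  have hE₄ : ‖fderiv ℝ (fderiv ℝ (fderiv ℝ (fderiv ℝ F))) (γ θ)‖ ≤ M₄ := by
    rw [norm_fderiv_four_eq_norm_iteratedFDeriv]; exact hM₄
  have hM10 : 0 ≤ M₁ := (norm_nonneg _).trans hE₁; have hM20 : 0 ≤ M₂ := (norm_nonneg _).trans hE₂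
  have hM30 : 0 ≤ M₃ := (norm_nonneg _).trans hE₃; have hM40 : 0 ≤ M₄ := (norm_nonneg _).trans hM₄
  have hD0 : 0 ≤ D := (norm_nonneg _).trans hD₁
  set v₁ := iteratedDeriv 1 γ θ; set v₂ := iteratedDeriv 2 γ θ; set v₃ := iteratedDeriv 3 γ θ; set v₄ := iteratedDeriv 4 γ θ
  have h4 : |fderiv ℝ (fderiv ℝ (fderiv ℝ (fderiv ℝ F))) (γ θ) v₁ v₁ v₁ v₁| ≤ M₄ * D ^ 4 := by
    calc _ ≤ M₄ * ‖v₁‖ * ‖v₁‖ * ‖v₁‖ * ‖v₁‖ := abs_apply₄_le_of_opNorm_le _ hE₄ _ _ _ _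
      _ ≤ M₄ * D * D * D * D := by gcongr
      _ = M₄ * D ^ 4 := by ring
  have h211 : |fderiv ℝ (fderiv ℝ (fderiv ℝ F)) (γ θ) v₂ v₁ v₁| ≤ M₃ * D ^ 4 := by
    calc _ ≤ M₃ * ‖v₂‖ * ‖v₁‖ * ‖v₁‖ := abs_apply₃_le_of_opNorm_le _ hE₃ _ _ _
      _ ≤ M₃ * D ^ 2 * D * D := by gcongr
      _ = M₃ * D ^ 4 := by ring
  have h121 : |fderiv ℝ (fderiv ℝ (fderiv ℝ F)) (γ θ) v₁ v₂ v₁| ≤ M₃ * D ^ 4 := by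
    calc _ ≤ M₃ * ‖v₁‖ * ‖v₂‖ * ‖v₁‖ := abs_apply₃_le_of_opNorm_le _ hE₃ _ _ _
      _ ≤ M₃ * D * D ^ 2 * D := by gcongr
      _ = M₃ * D ^ 4 := by ring
  have h112 : |fderiv ℝ (fderiv ℝ (fderiv ℝ F)) (γ θ) v₁ v₁ v₂| ≤ M₃ * D ^ 4 := by
    calc _ ≤ M₃ * ‖v₁‖ * ‖v₁‖ * ‖v₂‖ := abs_apply₃_le_of_opNorm_le _ hE₃ _ _ _
      _ ≤ M₃ * D * D * D ^ 2 := by gcongr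
      _ = M₃ * D ^ 4 := by ring
  have h31 : |fderiv ℝ (fderiv ℝ F) (γ θ) v₃ v₁| ≤ M₂ * D ^ 4 := by
    calc _ ≤ M₂ * ‖v₃‖ * ‖v₁‖ := abs_apply₂_le_of_opNorm_le _ hE₂ _ _
      _ ≤ M₂ * D ^ 3 * D := by gcongr
      _ = M₂ * D ^ 4 := by ring
  have h13 : |fderiv ℝ (fderiv ℝ F) (γ θ) v₁ v₃| ≤ M₂ * D ^ 4 := by
    calc _ ≤ M₂ * ‖v₁‖ * ‖v₃‖ := abs_apply₂_le_of_opNorm_le _ hE₂ _ _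
      _ ≤ M₂ * D * D ^ 3 := by gcongr
      _ = M₂ * D ^ 4 := by ring
  have h22 : |fderiv ℝ (fderiv ℝ F) (γ θ) v₂ v₂| ≤ M₂ * D ^ 4 := by
    calc _ ≤ M₂ * ‖v₂‖ * ‖v₂‖ := abs_apply₂_le_of_opNorm_le _ hE₂ _ _
      _ ≤ M₂ * D ^ 2 * D ^ 2 := by gcongr
      _ = M₂ * D ^ 4 := by ring
  have h1 : |fderiv ℝ F (γ θ) v₄| ≤ M₁ * D ^ 4 := (abs_apply_le_of_opNorm_le _ hE₁ _).trans (by gcongr)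
  have hM := abs_add_le_add (abs_add_le_add (abs_add_le_add (abs_add_le_add
    (abs_add_le_add (abs_add_le_add (abs_add_le_add h4 h211) h121) h112)
    (abs_add_le_add (abs_add_le_add h121 h31) h22))
    (abs_add_le_add (abs_add_le_add h112 h22) h13))
    (abs_add_le_add (abs_add_le_add h112 h22) h13)) (abs_add_le_add h13 h1)
  refine hM.trans (le_of_eq ?_)
  ring

end Four

end Bounds

/-! ## §4 Packaged: all four orders from graded hypotheses, and the uniform envelope `7·Σ_{k≤j} M_k` -/

section Packaged

variable {V : Type*} [NormedAddCommGroup V] [NormedSpace ℝ V] {F : V → ℝ} {γ : ℝ → V}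

/-- `F ∘ γ` is `C⁴`. [folklore] -/
theorem contDiff_four_comp (hF : ContDiff ℝ 4 F) (hγ : ContDiff ℝ 4 γ) : ContDiff ℝ 4 (F ∘ γ) := hF.comp hγ

/-- **The structured chain-rule bound, orders `1 … 4` at once.**  With `‖Dᵏ F(γ θ)‖ ≤ M k` (`1 ≤ k ≤ 4`) and `‖γ^{(i)}(θ)‖ ≤ Dⁱ`
(`1 ≤ i ≤ 4`): `|∂¹| ≤ M 1·D`, `|∂²| ≤ (M 2 + M 1)·D²`, `|∂³| ≤ (M 3 + 3 M 2 + M 1)·D³`, `|∂⁴| ≤ (M 4 + 6 M 3 + 7 M 2 + M 1)·D⁴`.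
[folklore] -/
theorem abs_iteratedDeriv_comp_le_stirling (hF : ContDiff ℝ 4 F) (hγ : ContDiff ℝ 4 γ) {θ D : ℝ} {M : ℕ → ℝ}
    (hM : ∀ k, 1 ≤ k → k ≤ 4 → ‖iteratedFDeriv ℝ k F (γ θ)‖ ≤ M k)
    (hD : ∀ i, 1 ≤ i → i ≤ 4 → ‖iteratedDeriv i γ θ‖ ≤ D ^ i) :
    |iteratedDeriv 1 (F ∘ γ) θ| ≤ M 1 * D ∧ |iteratedDeriv 2 (F ∘ γ) θ| ≤ (M 2 + M 1) * D ^ 2 ∧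
      |iteratedDeriv 3 (F ∘ γ) θ| ≤ (M 3 + 3 * M 2 + M 1) * D ^ 3 ∧
      |iteratedDeriv 4 (F ∘ γ) θ| ≤ (M 4 + 6 * M 3 + 7 * M 2 + M 1) * D ^ 4 := by
  have hD₁ : ‖iteratedDeriv 1 γ θ‖ ≤ D := by simpa using hD 1 le_rfl (by norm_num)
  have hD₂ := hD 2 (by norm_num) (by norm_num); have hD₃ := hD 3 (by norm_num) (by norm_num); have hD₄ := hD 4 (by norm_num) le_rfl
  have hM₁ := hM 1 le_rfl (by norm_num); have hM₂ := hM 2 (by norm_num) (by norm_num)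
  have hM₃ := hM 3 (by norm_num) (by norm_num); have hM₄ := hM 4 (by norm_num) le_rfl
  exact ⟨abs_iteratedDeriv_one_comp_le hF hγ hM₁ hD₁, abs_iteratedDeriv_two_comp_le hF hγ hM₁ hM₂ hD₁ hD₂,
    abs_iteratedDeriv_three_comp_le hF hγ hM₁ hM₂ hM₃ hD₁ hD₂ hD₃,
    abs_iteratedDeriv_four_comp_le hF hγ hM₁ hM₂ hM₃ hM₄ hD₁ hD₂ hD₃ hD₄⟩

/-- **Uniform envelope** (every Stirling number `S(j,k)`, `j ≤ 4`, is `≤ 7`): for `1 ≤ j ≤ 4`,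
`|∂ʲ(F∘γ)(θ)| ≤ 7·(Σ_{k=1}^{j} M k)·Dʲ`. [folklore] -/
theorem abs_iteratedDeriv_comp_le_envelope (hF : ContDiff ℝ 4 F) (hγ : ContDiff ℝ 4 γ) {θ D : ℝ} {M : ℕ → ℝ}
    (hM : ∀ k, 1 ≤ k → k ≤ 4 → ‖iteratedFDeriv ℝ k F (γ θ)‖ ≤ M k)
    (hD : ∀ i, 1 ≤ i → i ≤ 4 → ‖iteratedDeriv i γ θ‖ ≤ D ^ i) {j : ℕ} (hj1 : 1 ≤ j) (hj4 : j ≤ 4) :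
    |iteratedDeriv j (F ∘ γ) θ| ≤ 7 * (∑ k ∈ Finset.Icc 1 j, M k) * D ^ j := by
  obtain ⟨h1, h2, h3, h4⟩ := abs_iteratedDeriv_comp_le_stirling hF hγ hM hD
  have hM0 : ∀ k, 1 ≤ k → k ≤ 4 → 0 ≤ M k := fun k hk1 hk4 => (norm_nonneg _).trans (hM k hk1 hk4)
  have hD0 : 0 ≤ D := (norm_nonneg _).trans (by simpa using hD 1 le_rfl (by norm_num))
  have m1 := hM0 1 le_rfl (by norm_num); have m2 := hM0 2 (by norm_num) (by norm_num)
  have m3 := hM0 3 (by norm_num) (by norm_num); have m4 := hM0 4 (by norm_num) le_rfl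
  interval_cases j
  · refine h1.trans ?_
    simp only [Finset.Icc_self, Finset.sum_singleton, pow_one]
    nlinarith
  · refine h2.trans ?_
    rw [show Finset.Icc 1 2 = {1, 2} from by decide, Finset.sum_pair (by norm_num)]
    have := sq_nonneg D
    nlinarith
  · refine h3.trans ?_
    rw [show Finset.Icc 1 3 = {1, 2, 3} from by decide, Finset.sum_insert (by decide), Finset.sum_pair (by norm_num)]
    have : 0 ≤ D ^ 3 := pow_nonneg hD0 3
    nlinarith
  · refine h4.trans ?_
    rw [show Finset.Icc 1 4 = {1, 2, 3, 4} from by decide, Finset.sum_insert (by decide), Finset.sum_insert (by decide),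
      Finset.sum_pair (by norm_num)]
    have : 0 ≤ D ^ 4 := pow_nonneg hD0 4
    nlinarith

end Packaged

end Summit.HubbardSuperconductivity.HubbardSuperconductivity.Theorems.PerturbedFermiCurve

end
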